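import Summits.ResolutionOfSingularities.ResolutionOfSingularities.Theorems.FrobeniusLadderFInjectiveMacaulayficationX2Cubic4Specimen
import HarnessLib

/-!
# THE SPECIMEN PACKAGE OF BED B9 `z² + x⁹ + y⁹ + u⁹ + t⁹` (ANY characteristic `p ∤ 18`, `d = 4`): prime, no variable vanishes, vertex closed / singular / isolated / of dimension 4 / CM
# (crux `FInjectiveMacaulayfication` stmt-ResolutionOfSingularities-15315, chain w45a; res-L1-w45a-plan-1 RULING R22.7 (b) «stub-1 g13 SIDE-TASK: B9 INPUT SIDE p-uniform in
# `PointFloorNotFullOfFedder` currency — prime, x̄ᵢ ≠ 0, regular off v (isolated: p ∤ 18)»; template = res-L1-w45a-lead-1ʼs ✓ `X2Cubic4Specimen` VERBATIM with the cubes replaced by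
# ninth powers (its generic lemmas `natCast_ne_zero_of_prime_ne`, `two_three_ne_zero` are reused, not restated); seat res-L1-w45a-stub-1 g13)

[OURS · L1 W4.5a] Support file (`--supports stmt-ResolutionOfSingularities-15315 --as helper`); def-free, unconditional; replaces the role of NO printed item; NOT a statement of
the manuscript; AI-written (AI review is weaker than expert review).

B9 = the first F-side two-sided bed not tied to `p ∈ {2,3}` (res-L1-w45a-tri-2 g19 FIRST-STEP memo `B9-GENERIC-P-FSIDE-tri2.md`): `X = {z² + x⁹ + y⁹ + u⁹ + t⁹ = 0} ⊂ 𝔸⁵`, letters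
`X 0..X 3 = x,y,u,t`, `X 4 = z`, `f = X4² + X0⁹ + X1⁹ + X2⁹ + X3⁹`, `v` = the origin; hypotheses `(2 : k) ≠ 0`, `(3 : k) ≠ 0` (i.e. `p ∤ 18`).
* §1 `pderiv_four_f` (`2z`), `pderiv_ninth_f` (`9X_j⁸`), `constantCoeff_f`, ★ `prime_f` (`T² + C(c)`, `c = x⁹+y⁹+u⁹+t⁹`, Eisenstein-type at `(1,−1,0,0)`: `c = 0`, `∂c/∂x = 9 ≠ 0`),
  ★ `regular_off_vertex` (Jacobian off `𝔪`), `isIntegral_Y`, `f_not_mem_span_X`, `mk_X_ne_zero`;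
* §2 `isClosed_vertex`, `vertex_not_mem_regularLocus`, `ringKrullDim_stalk_vertex = 4`, `regular_of_ne_vertex`, `regular_off_closedPoint_vertex` (ISOLATED), `cmCl_Spec_stalk_vertex`.
The floor side (strict transforms, LEGAL, ★ NOT FULL for every `p ∤ 18`) is the sequel `…B9PointFloorNotFull`. [folklore mathematics, OURS as a certificate; cite: Hartshorne1977, I Thm. 5.1;
Matsumura1987, Thm. 17.4]
-/

-- single-problem summit: the doubled namespace component is forced
set_option linter.dupNamespace false

noncomputable section

open AlgebraicGeometry CategoryTheory Literature.AlgebraicGeometry.Resolution TopologicalSpace IsLocalRing MvPolynomial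

namespace Summit.ResolutionOfSingularities.ResolutionOfSingularities.Theorems.FInjectiveMacaulayfication.B9Specimen

open Summit.ResolutionOfSingularities.ResolutionOfSingularities.Theorems.FInjectiveMacaulayfication
open SliceableCentre GermForm GermOfGlobalBlowup FCentreE1RungZero X2Cubic4Specimen

/-! ## §1 Derivatives, primality, regularity off the vertex -/

/-- `∂f/∂z = 2z`. [folklore] -/
theorem pderiv_four_f (k : Type) [Field k] (f : MvPolynomial (Fin 5) k)
    (hf : f = X 4 ^ 2 + X 0 ^ 9 + X 1 ^ 9 + X 2 ^ 9 + X 3 ^ 9) : pderiv 4 f = 2 * X 4 := by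
  rw [hf]
  simp only [map_add, pderiv_pow, pderiv_X_self, pderiv_X_of_ne (show (0 : Fin 5) ≠ 4 by decide),
    pderiv_X_of_ne (show (1 : Fin 5) ≠ 4 by decide), pderiv_X_of_ne (show (2 : Fin 5) ≠ 4 by decide),
    pderiv_X_of_ne (show (3 : Fin 5) ≠ 4 by decide), mul_zero, mul_one, add_zero]
  push_cast
  ring

/-- `∂f/∂X_j = 9X_j⁸` for the ninth-power variables `j ∈ {0,1,2,3}`. [folklore] -/
theorem pderiv_ninth_f (k : Type) [Field k] (f : MvPolynomial (Fin 5) k)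
    (hf : f = X 4 ^ 2 + X 0 ^ 9 + X 1 ^ 9 + X 2 ^ 9 + X 3 ^ 9) (j : Fin 5) (hj : j = 0 ∨ j = 1 ∨ j = 2 ∨ j = 3) :
    pderiv j f = 9 * X j ^ 8 := by
  rw [hf]
  rcases hj with rfl | rfl | rfl | rfl
  all_goals
    simp only [map_add, pderiv_pow, pderiv_X_self, pderiv_X_of_ne (show (4 : Fin 5) ≠ 0 by decide),
      pderiv_X_of_ne (show (1 : Fin 5) ≠ 0 by decide), pderiv_X_of_ne (show (2 : Fin 5) ≠ 0 by decide),
      pderiv_X_of_ne (show (3 : Fin 5) ≠ 0 by decide), pderiv_X_of_ne (show (4 : Fin 5) ≠ 1 by decide),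
      pderiv_X_of_ne (show (0 : Fin 5) ≠ 1 by decide), pderiv_X_of_ne (show (2 : Fin 5) ≠ 1 by decide),
      pderiv_X_of_ne (show (3 : Fin 5) ≠ 1 by decide), pderiv_X_of_ne (show (4 : Fin 5) ≠ 2 by decide),
      pderiv_X_of_ne (show (0 : Fin 5) ≠ 2 by decide), pderiv_X_of_ne (show (1 : Fin 5) ≠ 2 by decide),
      pderiv_X_of_ne (show (3 : Fin 5) ≠ 2 by decide), pderiv_X_of_ne (show (4 : Fin 5) ≠ 3 by decide),
      pderiv_X_of_ne (show (0 : Fin 5) ≠ 3 by decide), pderiv_X_of_ne (show (1 : Fin 5) ≠ 3 by decide),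
      pderiv_X_of_ne (show (2 : Fin 5) ≠ 3 by decide), mul_zero, mul_one, zero_add, add_zero]
    push_cast
    ring

/-- `f` has no constant term. [folklore] -/
theorem constantCoeff_f (k : Type) [Field k] (f : MvPolynomial (Fin 5) k)
    (hf : f = X 4 ^ 2 + X 0 ^ 9 + X 1 ^ 9 + X 2 ^ 9 + X 3 ^ 9) : constantCoeff f = 0 := by
  rw [hf]
  simp [constantCoeff_X]

/-- **`f = z² + x⁹ + y⁹ + u⁹ + t⁹` is PRIME whenever `3 ≠ 0` in `k`**: as `T² + C(0)·T + C(c)` over `k[x,y,u,t]` (`z ↦ T`), `c = x⁹ + y⁹ + u⁹ + t⁹`, Eisenstein-type at the point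
`(1, −1, 0, 0)` where `c = 0` and `∂c/∂x = 9 ≠ 0` (`irreducible_X_pow_add_C_mul_X_add_C`). [folklore] -/
theorem prime_f (k : Type) [Field k] (h3 : (3 : k) ≠ 0) (f : MvPolynomial (Fin 5) k)
    (hf : f = X 4 ^ 2 + X 0 ^ 9 + X 1 ^ 9 + X 2 ^ 9 + X 3 ^ 9) : Prime f := by
  set e : MvPolynomial (Fin 5) k ≃+* Polynomial (MvPolynomial (Fin 4) k) :=
    ((renameEquiv k (_root_.finRotate 5)).trans (finSuccEquiv k 4)).toRingEquiv with he_def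
  have hrot4 : (_root_.finRotate 5) (4 : Fin 5) = 0 := by decide
  have hrot : ∀ j : Fin 4, (_root_.finRotate 5) (Fin.castSucc j) = j.succ := by decide
  have he4 : e (X 4) = Polynomial.X := by
    show finSuccEquiv k 4 (rename _ (X 4)) = _
    rw [rename_X, hrot4]; exact finSuccEquiv_X_zero
  have hej : ∀ j : Fin 4, e (X (Fin.castSucc j)) = Polynomial.C (X j) := fun j => by
    show finSuccEquiv k 4 (rename _ (X (Fin.castSucc j))) = _
    rw [rename_X, hrot j]; exact finSuccEquiv_X_succ (j := j)
  set c : MvPolynomial (Fin 4) k := X 0 ^ 9 + X 1 ^ 9 + X 2 ^ 9 + X 3 ^ 9 with hc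
  have hef : e f = Polynomial.X ^ 2 + Polynomial.C (0 : MvPolynomial (Fin 4) k) * Polynomial.X + Polynomial.C c := by
    rw [hf, map_add, map_add, map_add, map_add, map_pow, he4, map_pow, map_pow, map_pow, map_pow,
      show (0 : Fin 5) = Fin.castSucc (0 : Fin 4) from rfl, show (1 : Fin 5) = Fin.castSucc (1 : Fin 4) from rfl,
      show (2 : Fin 5) = Fin.castSucc (2 : Fin 4) from rfl, show (3 : Fin 5) = Fin.castSucc (3 : Fin 4) from rfl, hej, hej, hej, hej, hc]
    simp only [map_add, map_pow, map_zero, zero_mul, add_zero]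
    ring
  set a : Fin 4 → k := ![1, -1, 0, 0] with ha
  have hba : MvPolynomial.eval a (0 : MvPolynomial (Fin 4) k) = 0 := map_zero _
  have hca : MvPolynomial.eval a c = 0 := by
    rw [hc]
    simp only [map_add, map_pow, eval_X, ha, Matrix.cons_val_zero, Matrix.cons_val_one]
    simp only [Matrix.cons_val, one_pow, zero_pow (by norm_num : (9 : ℕ) ≠ 0), add_zero]
    ring
  have hder : MvPolynomial.eval a (pderiv 0 c) ≠ 0 := by
    have e1 : pderiv 0 c = 9 * X 0 ^ 8 := by
      rw [hc, map_add, map_add, map_add, pderiv_pow, pderiv_X_self, pderiv_pow, pderiv_X_of_ne (show (1 : Fin 4) ≠ 0 by decide),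
        pderiv_pow, pderiv_X_of_ne (show (2 : Fin 4) ≠ 0 by decide), pderiv_pow, pderiv_X_of_ne (show (3 : Fin 4) ≠ 0 by decide)]
      push_cast
      ring
    rw [e1, map_mul, map_pow, eval_X, ha]
    simp only [Matrix.cons_val_zero, one_pow, mul_one]
    rw [map_ofNat, show (9 : k) = 3 * 3 by norm_num]
    exact mul_ne_zero h3 h3
  have hirr : Irreducible (e f) := by
    rw [hef]
    exact Literature.AlgebraicGeometry.Motives.SmoothHypersurface.irreducible_X_pow_add_C_mul_X_add_C (d := 2) le_rfl 0 c a hba hca 0 hder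
  exact (MulEquiv.prime_iff e).mp hirr.prime

/-- **`(k[X]/(f))_P` is regular at every prime `P ⊉ (x̄, ȳ, ū, t̄, z̄)`** when `2 ≠ 0` and `3 ≠ 0` in `k`: some variable `X_j` misses `P`; then `∂f/∂X_j` (`= 9X_j⁸` or `2z`) misses
`P` too (Jacobian criterion, `HypersurfaceRegular.stub_hypersurfaceRegularOfPderiv`). [cite: Hartshorne1977, I Thm. 5.1] -/
theorem regular_off_vertex (k : Type) [Field k] (h2 : (2 : k) ≠ 0) (h3 : (3 : k) ≠ 0) (f : MvPolynomial (Fin 5) k)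
    (hf : f = X 4 ^ 2 + X 0 ^ 9 + X 1 ^ 9 + X 2 ^ 9 + X 3 ^ 9)
    (P : Ideal (MvPolynomial (Fin 5) k ⧸ Ideal.span {f})) [P.IsPrime]
    (hP : ¬ Ideal.span (Set.range fun j : Fin 5 => Ideal.Quotient.mk (Ideal.span {f}) (X j)) ≤ P) :
    IsRegularLocalRing (Localization.AtPrime P) := by
  have hP' : (P.comap (Ideal.Quotient.mk (Ideal.span {f}))).IsPrime := Ideal.comap_isPrime _ _
  set P' := P.comap (Ideal.Quotient.mk (Ideal.span {f})) with hP'def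
  have hex : ∃ j : Fin 5, (X j : MvPolynomial (Fin 5) k) ∉ P' := by
    by_contra hall
    push Not at hall
    apply hP
    rw [Ideal.span_le]
    rintro _ ⟨j, rfl⟩
    exact hall j
  obtain ⟨j, hj⟩ := hex
  have hC2 : (C (2 : k) : MvPolynomial (Fin 5) k) ∉ P' := fun h =>
    hP'.ne_top ((Ideal.eq_top_iff_one _).mpr (by
      have hu : IsUnit (C (2 : k) : MvPolynomial (Fin 5) k) := (isUnit_iff_ne_zero.mpr h2).map C
      exact (Ideal.unit_mul_mem_iff_mem _ hu).mp (by simpa using h)))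
  have h9 : (9 : k) ≠ 0 := by
    rw [show (9 : k) = 3 * 3 by norm_num]
    exact mul_ne_zero h3 h3
  have hC3 : (C (9 : k) : MvPolynomial (Fin 5) k) ∉ P' := fun h =>
    hP'.ne_top ((Ideal.eq_top_iff_one _).mpr (by
      have hu : IsUnit (C (9 : k) : MvPolynomial (Fin 5) k) := (isUnit_iff_ne_zero.mpr h9).map C
      exact (Ideal.unit_mul_mem_iff_mem _ hu).mp (by simpa using h)))
  by_cases hj4 : j = 4
  · subst hj4
    refine HypersurfaceRegular.stub_hypersurfaceRegularOfPderiv k 5 f 4 P ?_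
    rw [pderiv_four_f k f hf, show (2 : MvPolynomial (Fin 5) k) = C (2 : k) from (map_ofNat C 2).symm]
    exact fun h => (hP'.mem_or_mem h).elim hC2 hj
  · refine HypersurfaceRegular.stub_hypersurfaceRegularOfPderiv k 5 f j P ?_
    rw [pderiv_ninth_f k f hf j (eq_cube_index_of_ne_four j hj4), show (9 : MvPolynomial (Fin 5) k) = C (9 : k) from (map_ofNat C 9).symm]
    exact fun h => (hP'.mem_or_mem h).elim hC3 fun h' => hj (hP'.mem_of_pow_mem 8 h')

/-- `X` is integral (when `3 ≠ 0` in `k`). [folklore] -/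
theorem isIntegral_Y (k : Type) [Field k] (h3 : (3 : k) ≠ 0) (f : MvPolynomial (Fin 5) k)
    (hf : f = X 4 ^ 2 + X 0 ^ 9 + X 1 ^ 9 + X 2 ^ 9 + X 3 ^ 9) :
    IsIntegral (Spec (.of (MvPolynomial (Fin 5) k ⧸ Ideal.span {f}))) := by
  haveI := (Ideal.span_singleton_prime (prime_f k h3 f hf).ne_zero).mpr (prime_f k h3 f hf)
  haveI : IsDomain (MvPolynomial (Fin 5) k ⧸ Ideal.span {f}) := Ideal.Quotient.isDomain _
  infer_instance

/-- `f ∉ (X i)` for every variable (`f(e_x) = 1`; `f(1,0,0,0,0) = 1`). [certificate] -/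
theorem f_not_mem_span_X (k : Type) [Field k] (f : MvPolynomial (Fin 5) k)
    (hf : f = X 4 ^ 2 + X 0 ^ 9 + X 1 ^ 9 + X 2 ^ 9 + X 3 ^ 9) (i : Fin 5) :
    f ∉ Ideal.span {(X i : MvPolynomial (Fin 5) k)} := by
  intro h
  obtain ⟨c, hc⟩ := Ideal.mem_span_singleton.mp h
  by_cases hi : i = 4
  · subst hi
    have := congrArg (MvPolynomial.eval ![(1 : k), 0, 0, 0, 0]) hc
    rw [hf] at this
    simp at this
  · have := congrArg (MvPolynomial.eval (Pi.single 4 1 : Fin 5 → k)) hc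
    rw [hf] at this
    simp [hi] at this

/-- No variable vanishes on `Y`: `x̄_j ≠ 0` in `k[X]/(f)`. [folklore] -/
theorem mk_X_ne_zero (k : Type) [Field k] (h3 : (3 : k) ≠ 0) (f : MvPolynomial (Fin 5) k)
    (hf : f = X 4 ^ 2 + X 0 ^ 9 + X 1 ^ 9 + X 2 ^ 9 + X 3 ^ 9) (j : Fin 5) :
    Ideal.Quotient.mk (Ideal.span {f}) (X j) ≠ 0 := fun h0 =>
  PrimeTransfer.X_not_mem_span_of_isPrime ((Ideal.span_singleton_prime (prime_f k h3 f hf).ne_zero).mpr (prime_f k h3 f hf))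
    (f_not_mem_span_X k f hf j) (Ideal.Quotient.eq_zero_iff_mem.mp h0)

/-! ## §2 The binders at the vertex -/

/-- (H1) the vertex is closed. [folklore] -/
theorem isClosed_vertex (k : Type) [Field k] (f : MvPolynomial (Fin 5) k)
    (hf : f = X 4 ^ 2 + X 0 ^ 9 + X 1 ^ 9 + X 2 ^ 9 + X 3 ^ 9)
    (v : Spec (.of (MvPolynomial (Fin 5) k ⧸ Ideal.span {f})))
    (hv : v.asIdeal = Ideal.span (Set.range fun j : Fin 5 => Ideal.Quotient.mk (Ideal.span {f}) (X j))) :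
    IsClosed ({v} : Set (Spec (.of (MvPolynomial (Fin 5) k ⧸ Ideal.span {f})))) :=
  DoublePointFermatCubicGerm.isClosed_origin k f (constantCoeff_f k f hf) v hv

/-- (H2) the vertex is NOT regular: `f(0) = 0`, `∇f(0) = 0`. [cite: Hartshorne1977, I Thm. 5.1] -/
theorem vertex_not_mem_regularLocus (k : Type) [Field k] (h3 : (3 : k) ≠ 0) (f : MvPolynomial (Fin 5) k)
    (hf : f = X 4 ^ 2 + X 0 ^ 9 + X 1 ^ 9 + X 2 ^ 9 + X 3 ^ 9)
    (v : Spec (.of (MvPolynomial (Fin 5) k ⧸ Ideal.span {f})))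
    (hv : v.asIdeal = Ideal.span (Set.range fun j : Fin 5 => Ideal.Quotient.mk (Ideal.span {f}) (X j))) :
    v ∉ Scheme.regularLocus (Spec (.of (MvPolynomial (Fin 5) k ⧸ Ideal.span {f}))) := by
  classical
  refine not_mem_regularLocus_Spec_of_not_isRegularLocalRing v ?_
  refine not_isRegularLocalRing_localization_of_pderiv_eval_eq_zero (0 : Fin 5 → k) (prime_f k h3 f hf).ne_zero ?_ ?_ v.asIdeal ?_
  · rw [MvPolynomial.eval_zero]
    exact constantCoeff_f k f hf
  · intro i
    by_cases hi4 : i = 4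
    · subst hi4
      rw [pderiv_four_f k f hf, map_mul, MvPolynomial.eval_X, Pi.zero_apply, mul_zero]
    · rw [pderiv_ninth_f k f hf i (eq_cube_index_of_ne_four i hi4), map_mul, map_pow, MvPolynomial.eval_X, Pi.zero_apply, zero_pow (by norm_num : (8 : ℕ) ≠ 0), mul_zero]
  · rw [hv, DoublePointFermatCubicGerm.comap_origin k f (constantCoeff_f k f hf), MvPolynomial.eval_zero, Fedder.span_range_X_eq_ker]

/-- (H3) `dim 𝒪_{Y,v} = 4`. [cite: Matsumura1987, Thm. 13.5] -/
theorem ringKrullDim_stalk_vertex (k : Type) [Field k] (h3 : (3 : k) ≠ 0) (f : MvPolynomial (Fin 5) k)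
    (hf : f = X 4 ^ 2 + X 0 ^ 9 + X 1 ^ 9 + X 2 ^ 9 + X 3 ^ 9)
    (v : Spec (.of (MvPolynomial (Fin 5) k ⧸ Ideal.span {f})))
    (hv : v.asIdeal = Ideal.span (Set.range fun j : Fin 5 => Ideal.Quotient.mk (Ideal.span {f}) (X j))) :
    ringKrullDim ((Spec (.of (MvPolynomial (Fin 5) k ⧸ Ideal.span {f}))).presheaf.stalk v) = (4 : ℕ) := by
  haveI : v.asIdeal.IsMaximal := by
    rw [hv]
    exact DoublePointFermatCubicGerm.isMaximal_origin k f (constantCoeff_f k f hf)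
  rw [ringKrullDim_stalk_Spec_eq]
  exact HypersurfaceLocalDim.stub_hypersurfaceLocalDim k 4 f (prime_f k h3 f hf).ne_zero v.asIdeal

/-- `Y` is regular at every point other than the vertex (when `2, 3 ≠ 0` in `k`). [cite: Hartshorne1977, I Thm. 5.1] -/
theorem regular_of_ne_vertex (k : Type) [Field k] (h2 : (2 : k) ≠ 0) (h3 : (3 : k) ≠ 0) (f : MvPolynomial (Fin 5) k)
    (hf : f = X 4 ^ 2 + X 0 ^ 9 + X 1 ^ 9 + X 2 ^ 9 + X 3 ^ 9)
    (v : Spec (.of (MvPolynomial (Fin 5) k ⧸ Ideal.span {f})))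
    (hv : v.asIdeal = Ideal.span (Set.range fun j : Fin 5 => Ideal.Quotient.mk (Ideal.span {f}) (X j))) :
    ∀ y : Spec (.of (MvPolynomial (Fin 5) k ⧸ Ideal.span {f})), y ⤳ v → y ≠ v →
      y ∈ Scheme.regularLocus (Spec (.of (MvPolynomial (Fin 5) k ⧸ Ideal.span {f}))) := by
  intro y hy hne
  refine FermatCubicConeGerm.mem_regularLocus_Spec_of_isRegularLocalRing y (regular_off_vertex k h2 h3 f hf y.asIdeal fun hle => hne ?_)
  have hyv : y.asIdeal ≤ v.asIdeal := (PrimeSpectrum.le_iff_specializes y v).mpr hy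
  exact PrimeSpectrum.ext (le_antisymm hyv (hv ▸ hle))

/-- (H4) ISOLATED: `Spec 𝒪_{Y,v}` is regular off its closed point. [cite: Temkin2008, §2.1] -/
theorem regular_off_closedPoint_vertex (k : Type) [Field k] (h2 : (2 : k) ≠ 0) (h3 : (3 : k) ≠ 0) (f : MvPolynomial (Fin 5) k)
    (hf : f = X 4 ^ 2 + X 0 ^ 9 + X 1 ^ 9 + X 2 ^ 9 + X 3 ^ 9)
    (v : Spec (.of (MvPolynomial (Fin 5) k ⧸ Ideal.span {f})))
    (hv : v.asIdeal = Ideal.span (Set.range fun j : Fin 5 => Ideal.Quotient.mk (Ideal.span {f}) (X j))) :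
    ∀ s : Spec ((Spec (.of (MvPolynomial (Fin 5) k ⧸ Ideal.span {f}))).presheaf.stalk v),
      s ≠ closedPoint _ → s ∈ Scheme.regularLocus (Spec ((Spec (.of (MvPolynomial (Fin 5) k ⧸ Ideal.span {f}))).presheaf.stalk v)) :=
  regularLocus_Spec_stalk_of_isolated v (regular_of_ne_vertex k h2 h3 f hf v hv)

/-- (H5) the CM-clause at every point of `Spec 𝒪_{Y,v}`. [cite: Matsumura1987, Thm. 17.4 and Thm. 17.8] -/
theorem cmCl_Spec_stalk_vertex (k : Type) [Field k] (h2 : (2 : k) ≠ 0) (h3 : (3 : k) ≠ 0) (f : MvPolynomial (Fin 5) k)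
    (hf : f = X 4 ^ 2 + X 0 ^ 9 + X 1 ^ 9 + X 2 ^ 9 + X 3 ^ 9)
    (v : Spec (.of (MvPolynomial (Fin 5) k ⧸ Ideal.span {f})))
    (hv : v.asIdeal = Ideal.span (Set.range fun j : Fin 5 => Ideal.Quotient.mk (Ideal.span {f}) (X j))) :
    ∀ s : Spec ((Spec (.of (MvPolynomial (Fin 5) k ⧸ Ideal.span {f}))).presheaf.stalk v),
      CMCl ((Spec ((Spec (.of (MvPolynomial (Fin 5) k ⧸ Ideal.span {f}))).presheaf.stalk v)).presheaf.stalk s) :=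
  cmCl_Spec_stalk_of_isolated v (cmCl_stalk_Spec_of_cmCl_localization v
    (DoublePointFermatCubicGerm.cmCl_localization_hypersurface k f (prime_f k h3 f hf).ne_zero v)) (regular_of_ne_vertex k h2 h3 f hf v hv)

end Summit.ResolutionOfSingularities.ResolutionOfSingularities.Theorems.FInjectiveMacaulayfication.B9Specimen

end
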